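import Summits.AnomalousDissipation.AnomalousDissipation.Theorems.BaireTransferRobustLoudUpgradeStubDriftLimit

/-!
# Stub `stub_driftCorrespondenceUhc` of the line `malkin-cone-group-orbits`
# (crux stmt-AnomalousDissipation-1144, lead c15, wave 4):
# the DRIFTED steady correspondence of a stratum is upper hemicontinuous

For a stratum index `n` the drifted steady correspondence
`Φₙ(c) = {(ν, m, W) : ν ∈ [1/(n+1), n], ‖m‖ ≤ n, ‖∇W‖² ≤ n², (W, m) a drifted steady weak solution
of NS_ν(f_c)}` (values in `ℝ × ℝ³ × H`; the drifted steady weak identity is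
`⟨F_{ν,c}(W), w⟩ + ∫ ⟪Dw(y) m, W(y)⟫ dy = 0` for every test field `w ∈ 𝒱`) is UPPER HEMICONTINUOUS
in the coefficient vector `c ∈ P_S`.  Proof (the structure of the undrifted
`Category.stub_steadyCorrespondenceUhc`): all values lie in the fixed compact set
`K = [1/(n+1), n] × B̄(0, n) × {‖∇W‖² ≤ n²}` (closed balls of the finite-dimensional `ℝ³` are
compact; Rellich, `isCompact_setOf_eGradNormSq_le`), so by the sequential criterion
`UpperHemicontinuousAt.of_sequences` it suffices to check that the graph is closed along sequences:
if `c_k → c`, `(ν_k, m_k, W_k) ∈ Φₙ(c_k)` and `(ν_k, m_k, W_k) → (ν, m, W)`, then `(ν, m, W) ∈ K`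
(closed) and `(W, m)` is a drifted steady weak solution of `NS_ν(f_c)` — the closed-graph lemma
`Category.stub_driftLimit` applied to the three coordinate sequences.
-/

-- `Summit.<Summit>.<Problem>` is the tree's mandated summit-side namespace (CONVENTIONS §2); for this
-- single-conjunct summit the two coincide, so the duplicate is deliberate.
set_option linter.dupNamespace false

noncomputable section

open scoped BigOperators Topology InnerProductSpace RealInnerProductSpace ENNReal
open Filter Set Function TopologicalSpace MeasureTheory

namespace Summit.AnomalousDissipation.AnomalousDissipation.Theorems.RobustLoudUpgrade.Category

open Literature.Analysis.FunctionSpaces Literature.Analysis.FunctionSpaces.Torus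
open Literature.Analysis.FluidPDE Literature.Analysis.FluidPDE.Torus
open Summit.AnomalousDissipation.AnomalousDissipation.Theses.BaireTransfer
open Summit.AnomalousDissipation.AnomalousDissipation.Theorems.DenseLoudDesignerForces
open Summit.AnomalousDissipation.AnomalousDissipation.Theorems.RobustLoudUpgrade.CensusInterior

/-! ## §1 The fixed compact set of values -/

/-- **The compact box of the drifted stratum.**  The set
`K = [1/(n+1), n] × B̄(0, n) × {W ∈ H : ‖∇W‖² ≤ n²}` of `ℝ × ℝ³ × H` is compact: a compact
viscosity slab, a closed ball of the finite-dimensional (proper) space `ℝ³`, and an enstrophy ball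
of `H` (Rellich, `isCompact_setOf_eGradNormSq_le`). [folklore] -/
theorem isCompact_driftStratumBox (n : ℕ) :
    IsCompact (Icc (1 / ((n : ℝ) + 1)) (n : ℝ) ×ˢ
      (Metric.closedBall (0 : EuclideanSpace ℝ (Fin 3)) (n : ℝ) ×ˢ
        {W : energySpace (Fin 3) |
          eGradNormSq (W.1 : UnitAddTorus (Fin 3) → EuclideanSpace ℝ (Fin 3)) ≤
            ENNReal.ofReal ((n : ℝ) ^ 2)})) :=
  isCompact_Icc.prod
    ((isCompact_closedBall _ _).prod (isCompact_setOf_eGradNormSq_le ENNReal.ofReal_ne_top))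

/-- **The compact box of the drifted stratum is closed** (product of a closed interval, a closed
ball and a closed enstrophy ball, `isClosed_setOf_eGradNormSq_le`). [folklore] -/
theorem isClosed_driftStratumBox (n : ℕ) :
    IsClosed (Icc (1 / ((n : ℝ) + 1)) (n : ℝ) ×ˢ
      (Metric.closedBall (0 : EuclideanSpace ℝ (Fin 3)) (n : ℝ) ×ˢ
        {W : energySpace (Fin 3) |
          eGradNormSq (W.1 : UnitAddTorus (Fin 3) → EuclideanSpace ℝ (Fin 3)) ≤
            ENNReal.ofReal ((n : ℝ) ^ 2)})) :=
  isClosed_Icc.prod (Metric.isClosed_closedBall.prod (isClosed_setOf_eGradNormSq_le _))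

/-! ## §2 The stub -/

/-- **stub_driftCorrespondenceUhc** (registered sub-goal, c15 wave 4).  The drifted steady
correspondence of the stratum `n` — triples `(ν, m, W)` with `ν ∈ [1/(n+1), n]`, `‖m‖ ≤ n`,
`‖∇W‖² ≤ n²` and `(W, m)` a drifted steady weak solution of `NS_ν(f_c)` — is UPPER HEMICONTINUOUS
in `c` (closed graph by the drifted closed-graph lemma `stub_driftLimit` along the coordinate
sequences, values in the fixed compact set `[1/(n+1), n] × B̄(0, n) × {‖∇W‖² ≤ n²}`; sequences
suffice in the metric space `P_S`, `UpperHemicontinuousAt.of_sequences`). [folklore] -/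
theorem stub_driftCorrespondenceUhc : ∀ (S : Finset (Fin 3 → ℤ)) (n : ℕ),
    UpperHemicontinuous (fun c : Coeff S =>
      {q : ℝ × EuclideanSpace ℝ (Fin 3) × energySpace (Fin 3) | 1 / ((n : ℝ) + 1) ≤ q.1 ∧ q.1 ≤ (n : ℝ) ∧ ‖q.2.1‖ ≤ (n : ℝ) ∧
        eGradNormSq (q.2.2.1 : UnitAddTorus (Fin 3) → EuclideanSpace ℝ (Fin 3)) ≤ ENNReal.ofReal ((n : ℝ) ^ 2) ∧
        ∀ w : UnitAddTorus (Fin 3) → EuclideanSpace ℝ (Fin 3), IsSmooth w → IsDivFree w → HasZeroMean w →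
          Torus.nsGeneratorPairing q.1 (force S c) q.2.2 w +
            ∫ x, ⟪Torus.fderiv w x q.2.1, (q.2.2.1 : UnitAddTorus (Fin 3) → EuclideanSpace ℝ (Fin 3)) x⟫_ℝ = 0}) := by
  intro S n
  -- the fixed compact (hence closed) set of values: viscosity slab × drift ball × enstrophy ball
  set K : Set (ℝ × EuclideanSpace ℝ (Fin 3) × energySpace (Fin 3)) :=
    Icc (1 / ((n : ℝ) + 1)) (n : ℝ) ×ˢ
      (Metric.closedBall (0 : EuclideanSpace ℝ (Fin 3)) (n : ℝ) ×ˢ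
        {W : energySpace (Fin 3) |
          eGradNormSq (W.1 : UnitAddTorus (Fin 3) → EuclideanSpace ℝ (Fin 3)) ≤
            ENNReal.ofReal ((n : ℝ) ^ 2)}) with hKdef
  have hKc : IsCompact K := isCompact_driftStratumBox n
  have hKcl : IsClosed K := isClosed_driftStratumBox n
  refine upperHemicontinuous_iff.2 fun c => ?_
  refine UpperHemicontinuousAt.of_sequences hKc.isSeqCompact
    (Eventually.of_forall fun c' q hq =>
      ⟨⟨hq.1, hq.2.1⟩, mem_closedBall_zero_iff.2 hq.2.2.1, hq.2.2.2.1⟩) ?_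
  intro x hxc q hq q₀ hq₀
  -- the limit lies in the closed set `K` ...
  have hK₀ : q₀ ∈ K :=
    hKcl.mem_of_tendsto hq₀ (Eventually.of_forall fun k =>
      ⟨⟨(hq k).1, (hq k).2.1⟩, mem_closedBall_zero_iff.2 (hq k).2.2.1, (hq k).2.2.2.1⟩)
  -- ... and `(W₀, m₀)` is a drifted steady weak solution of `NS_{ν₀}(f_c)` by the closed-graph lemma
  -- `stub_driftLimit` applied to the coordinate sequences `ν_k = (q k).1`, `m_k = (q k).2.1`,
  -- `W_k = (q k).2.2`
  exact ⟨hK₀.1.1, hK₀.1.2, mem_closedBall_zero_iff.1 hK₀.2.1, hK₀.2.2,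
    stub_driftLimit S x c (fun k => (q k).1) q₀.1 (fun k => (q k).2.1) q₀.2.1
      (fun k => (q k).2.2) q₀.2.2 hxc hq₀.fst_nhds hq₀.snd_nhds.fst_nhds hq₀.snd_nhds.snd_nhds
      fun k => (hq k).2.2.2.2⟩

end Summit.AnomalousDissipation.AnomalousDissipation.Theorems.RobustLoudUpgrade.Category

end
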